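import Literature.Computability.QuantumComplexity.PolyMajority
import HarnessLib

/-!
# Acceptance-gap–parametrised quantum polynomial time: Watrous's `BQP(a, b)`, the gap dial `BQPGap γ`, and `PQP`

Topic `Literature/Computability/QuantumComplexity`, in the machine model of the tree's `BQP`
(`Cryptography/ClassBQP.lean`: poly-time uniform, oracle-free families of Clifford+T circuits,
acceptance = measuring output wire `0`, `QCircuitFamily.acceptProbOn 0`).

Watrous, *Quantum computational complexity* (2009), §IV.1 prints the two-parameter class: "Let
`A = (A_yes, A_no)` be a promise problem and let `a, b : ℕ → [0,1]` be functions. Then `A ∈ BQP(a, b)`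
if and only if there exists a polynomial-time generated family of quantum circuits
`Q = {Q_n : n ∈ ℕ}`, where each circuit `Q_n` takes `n` input qubits and produces one output qubit,
that satisfies the following properties: if `x ∈ A_yes` then `Pr[Q accepts x] ≥ a(|x|)`, and if
`x ∈ A_no` then `Pr[Q accepts x] ≤ b(|x|)`. The class BQP is defined as `BQP = BQP(2/3, 1/3)`."
§IV.2, Prop. 3 (error reduction): for polynomial-time computable `a, b` with `a(n) - b(n) ≥ 1/p(n)`,
`BQP(a, b) = BQP = BQP(1 - 2^{-q}, 2^{-q})`. §IV.5 prints the unbounded-error class: "`A ∈ PQP` if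
and only if there exists a polynomial-time generated family of quantum circuits … If `x ∈ A_yes` then
`Pr[Q accepts x] > 1/2`; and if `x ∈ A_no` then `Pr[Q accepts x] ≤ 1/2`", with Thm. 7: `PQP = PP`.

Contents (languages, as everywhere in the tree's complexity library; the promise versions are not
needed by the requester):

* `BQPBounds a b` — Watrous's `BQP(a, b)` for languages, `a b : ℕ → ℝ` evaluated at the input
  length; `BQPWith_eq_BQPBounds`, `BQP_eq_BQPBounds` (the tree's `BQP` is `BQP(2/3, 1/3)`),
  `BQPBounds_mono`;
* `BQPGap γ := BQPBounds (1/2 + γ) (1/2 - γ)` — the **acceptance-gap dial** asked for by the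
  route `Summits/QuantumAdvantage/…` (decomp-qadv lens 1, request D2): two-sided gap `γ(n)` around
  `1/2` instead of the constant `1/6`; `BQPGap_anti` (monotonicity), `BQPGap_const_eq_BQPWith`,
  `BQPGap_sixth_eq_BQP` (`BQPGap (1/6) = BQP`, definitional up to arithmetic),
  `BQP_subset_BQPGap_of_le_sixth`;
* `PQP` — the unbounded-error class of §IV.5, and `BQPGap_subset_PQP` (every positive gap),
  `BQP_subset_PQP`;
* **Prop. 3 for the gap dial, proved**: `exists_poly_amplified_fn` (majority vote over `K(n)`
  copies with an input-length–dependent advantage `η(n)`, the per-`n` reading of the tree theorem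
  `exists_poly_amplified` of `PolyMajority.lean` — Bennett–Bernstein–Brassard–Vazirani 1997,
  Thm. 4.13), `BQPGap_subset_BQP_of_inv_poly` (gap `≥ 1/(q(n)+1)` ⇒ in `BQP`),
  `BQP_subset_BQPGap_of_le` (gap `≤ 1/2 - 1/(q(n)+1)`), `BQPGap_eq_BQP_of_inv_poly`, and the
  constant case `BQPGap_const_eq_BQP` (every constant gap in `(0, 1/2)`).

What is NOT formalised here (no named facts are minted): the re-centring step of Prop. 3 for a
general computable pair `(a, b)` with midpoint `≠ 1/2`; the exponential-error half
`BQP = BQP(1 - 2^{-q}, 2^{-q})` (needs a Chernoff bound; the tree's majority amplification is the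
Chebyshev estimate `1/(4Kη²)`); Thm. 7 `PQP = PP` (Watrous 2009 §IV.5; Adleman–DeMarrais–Huang 1997,
Thm. 6.4) — the tree's `BQP_subset_PP_holds` (`BQPSubsetPP.lean`) uses the `2/3 ∕ 1/3` gap.

## References

* J. Watrous, *Quantum computational complexity*, in: Encyclopedia of Complexity and Systems
  Science, Springer 2009 (arXiv:0804.3401), §IV.1 (definition of `BQP(a, b)`, `BQP = BQP(2/3, 1/3)`),
  §IV.2 Prop. 3 (error reduction), §IV.5 (definition of `PQP`, Thm. 7 `PQP = PP`) [Watrous2009].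
* C. H. Bennett, E. Bernstein, G. Brassard, U. Vazirani, *Strengths and weaknesses of quantum
  computing*, SIAM J. Comput. 26 (1997) 1510–1523, Thm. 4.13 (majority vote over `k` copies)
  [BennettBernsteinBrassardVazirani1997].
* E. Bernstein, U. Vazirani, *Quantum complexity theory*, SIAM J. Comput. 26 (1997), §8.1 Def. 8.1,
  §8.2 Thm. 8.5 [BernsteinVazirani1997].

## Tree dependencies

`Cryptography.BQP`, `BQPWith`, `ClassBQP.mem_BQP_iff` (`ClassBQP.lean`), `PolyCopies.*` and `exists_poly_amplified`
(`PolyCopies.lean`, `PolyMajority.lean`), `CWrap.*` (`CWrapKernel.lean`, `CWrapAssembly.lean`),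
`kernelProb_prefix_true_eq_acceptProbOn`, `kernelProb_add_kernelProb_le_one`,
`disjoint_prefix_true_false` (`BPPRelSubsetBQPRel.lean`). Mathlib has no complexity classes.
-/

noncomputable section

namespace Literature.Computability.QuantumComplexity

open _root_.Computability Complexity Cryptography

/-! ### Watrous's two-parameter class `BQP(a, b)` -/

/-- **`BQPBounds a b = BQP(a, b)`** (languages): `L` is in the class iff some polynomial-time uniform,
oracle-free family of Clifford+T circuits accepts every `x ∈ L` with probability `≥ a(|x|)` and every
`x ∉ L` with probability `≤ b(|x|)` — "if `x ∈ A_yes` then `Pr[Q accepts x] ≥ a(|x|)`, and if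
`x ∈ A_no` then `Pr[Q accepts x] ≤ b(|x|)`". The bounds are real-valued functions of the input length
(print: `a, b : ℕ → [0,1]`; values outside `[0,1]` only make a clause vacuous or unsatisfiable).
[cite: Watrous2009, §IV.1 (arXiv:0804.3401 §4.1, definition of BQP(a,b))] -/
def BQPBounds (a b : ℕ → ℝ) : Set (Language Bool) :=
  {L | ∃ F : QCircuitFamily cliffordT, F.IsOracleFree ∧ F.IsUniform ∧
    ∀ x, (x ∈ L → a x.length ≤ F.acceptProbOn 0 x) ∧ (x ∉ L → F.acceptProbOn 0 x ≤ b x.length)}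

/-- **The acceptance-gap dial `BQPGap γ = BQP(1/2 + γ, 1/2 - γ)`**: languages decided by a
polynomial-time uniform, oracle-free Clifford+T family with acceptance probability `≥ 1/2 + γ(|x|)` on
members and `≤ 1/2 - γ(|x|)` on non-members (two-sided gap `γ` in place of `BQP`'s constant `1/6`).
[cite: Watrous2009, §IV.1 (arXiv:0804.3401 §4.1, BQP(a,b) with a = 1/2 + γ, b = 1/2 − γ)] -/
def BQPGap (γ : ℕ → ℝ) : Set (Language Bool) :=
  BQPBounds (fun n => 1 / 2 + γ n) (fun n => 1 / 2 - γ n)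

/-- **`PQP`**, unbounded-error quantum polynomial time (languages): some polynomial-time uniform,
oracle-free Clifford+T family accepts every member with probability `> 1/2` and every non-member with
probability `≤ 1/2` — "If `x ∈ A_yes` then `Pr[Q accepts x] > 1/2`; and if `x ∈ A_no` then
`Pr[Q accepts x] ≤ 1/2`." Print: `PQP = PP` (Thm. 7; not formalised here).
[cite: Watrous2009, §IV.5 (arXiv:0804.3401 §4.5, definition of PQP)] -/
def PQP : Set (Language Bool) :=
  {L | ∃ F : QCircuitFamily cliffordT, F.IsOracleFree ∧ F.IsUniform ∧
    ∀ x, (x ∈ L → 1 / 2 < F.acceptProbOn 0 x) ∧ (x ∉ L → F.acceptProbOn 0 x ≤ 1 / 2)}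

/-! ### Unfolding and monotonicity -/

section API

variable {a a' b b' γ γ' : ℕ → ℝ}

/-- Unfolding lemma for `BQPBounds`. [cite: Watrous2009, §IV.1 (definition of BQP(a,b))] -/
theorem mem_BQPBounds_iff {L : Language Bool} :
    L ∈ BQPBounds a b ↔ ∃ F : QCircuitFamily cliffordT, F.IsOracleFree ∧ F.IsUniform ∧
      ∀ x, (x ∈ L → a x.length ≤ F.acceptProbOn 0 x) ∧ (x ∉ L → F.acceptProbOn 0 x ≤ b x.length) :=
  Iff.rfl

/-- Unfolding lemma for `BQPGap`. [cite: Watrous2009, §IV.1 (definition of BQP(a,b))] -/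
theorem mem_BQPGap_iff {L : Language Bool} :
    L ∈ BQPGap γ ↔ ∃ F : QCircuitFamily cliffordT, F.IsOracleFree ∧ F.IsUniform ∧
      ∀ x, (x ∈ L → 1 / 2 + γ x.length ≤ F.acceptProbOn 0 x) ∧
        (x ∉ L → F.acceptProbOn 0 x ≤ 1 / 2 - γ x.length) :=
  Iff.rfl

/-- Unfolding lemma for `PQP`. [cite: Watrous2009, §IV.5 (definition of PQP)] -/
theorem mem_PQP_iff {L : Language Bool} :
    L ∈ PQP ↔ ∃ F : QCircuitFamily cliffordT, F.IsOracleFree ∧ F.IsUniform ∧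
      ∀ x, (x ∈ L → 1 / 2 < F.acceptProbOn 0 x) ∧ (x ∉ L → F.acceptProbOn 0 x ≤ 1 / 2) :=
  Iff.rfl

/-- `BQP(a, b)` grows when the yes-threshold is lowered and the no-threshold is raised (the same
family witnesses membership). [cite: Watrous2009, §IV.1 (definition of BQP(a,b))] -/
theorem BQPBounds_mono (ha : ∀ n, a' n ≤ a n) (hb : ∀ n, b n ≤ b' n) :
    BQPBounds a b ⊆ BQPBounds a' b' := by
  rintro L ⟨F, hF, hU, hL⟩
  exact ⟨F, hF, hU, fun x => ⟨fun hx => (ha _).trans ((hL x).1 hx), fun hx => ((hL x).2 hx).trans (hb _)⟩⟩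

/-- The tree's constant-error class is a `BQP(a, b)`: `BQPWith cliffordT ε = BQP(1 - ε, ε)`
(definitional). [cite: Watrous2009, §IV.1 (BQP(a,b) with constant a, b)] -/
theorem BQPWith_eq_BQPBounds (ε : ℝ) :
    BQPWith cliffordT ε = BQPBounds (fun _ => 1 - ε) (fun _ => ε) :=
  rfl

/-- "The class BQP is defined as `BQP = BQP(2/3, 1/3)`" — for the tree's `BQP`
(`= BQPWith cliffordT (1/3)`, thresholds `1 - 1/3` and `1/3`). [cite: Watrous2009, §IV.1 (BQP = BQP(2/3,1/3))] -/
theorem BQP_eq_BQPBounds : BQP = BQPBounds (fun _ => 2 / 3) (fun _ => 1 / 3) := by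
  ext L
  rw [ClassBQP.mem_BQP_iff, mem_BQPBounds_iff]

/-- **Monotonicity of the gap dial**: a larger gap is a stronger requirement,
`γ ≤ γ'` pointwise ⇒ `BQPGap γ' ⊆ BQPGap γ`. [cite: Watrous2009, §IV.1 (definition of BQP(a,b))] -/
theorem BQPGap_anti (h : ∀ n, γ n ≤ γ' n) : BQPGap γ' ⊆ BQPGap γ :=
  BQPBounds_mono (fun n => by linarith [h n]) (fun n => by linarith [h n])

/-- A constant gap `c` is the constant error `1/2 - c`: `BQPGap (fun _ => c) = BQPWith cliffordT (1/2 - c)`.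
[cite: Watrous2009, §IV.1 (BQP(a,b) with constant a, b)] -/
theorem BQPGap_const_eq_BQPWith (c : ℝ) : BQPGap (fun _ => c) = BQPWith cliffordT (1 / 2 - c) := by
  rw [BQPWith_eq_BQPBounds, BQPGap]
  congr 1
  funext n
  ring

/-- **`BQPGap (1/6) = BQP`**: the gap `1/6` around `1/2` is exactly the thresholds `2/3 ∕ 1/3` (no
amplification involved). [cite: Watrous2009, §IV.1 (BQP = BQP(2/3,1/3))] -/
theorem BQPGap_sixth_eq_BQP : BQPGap (fun _ => (1 : ℝ) / 6) = BQP := by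
  rw [BQP_eq_BQPBounds, BQPGap]
  congr 1 <;> funext n <;> norm_num

/-- `BQP ⊆ BQPGap γ` as soon as `γ ≤ 1/6` everywhere (monotonicity from `BQPGap (1/6) = BQP`).
[cite: Watrous2009, §IV.1 (definition of BQP(a,b))] -/
theorem BQP_subset_BQPGap_of_le_sixth (h : ∀ n, γ n ≤ 1 / 6) : BQP ⊆ BQPGap γ := by
  rw [← BQPGap_sixth_eq_BQP]
  exact BQPGap_anti h

/-- **Every positive gap is unbounded-error**: `0 < γ` everywhere ⇒ `BQPGap γ ⊆ PQP` (the same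
family). [cite: Watrous2009, §IV.5 (definition of PQP)] -/
theorem BQPGap_subset_PQP (h : ∀ n, 0 < γ n) : BQPGap γ ⊆ PQP := by
  rintro L ⟨F, hF, hU, hL⟩
  refine ⟨F, hF, hU, fun x => ⟨fun hx => ?_, fun hx => ?_⟩⟩
  · have := (hL x).1 hx
    dsimp only at this
    linarith [h x.length]
  · have := (hL x).2 hx
    dsimp only at this
    linarith [h x.length]

/-- `BQP ⊆ PQP`. [cite: Watrous2009, §IV.5 ("an unbounded error variant of BQP")] -/
theorem BQP_subset_PQP : BQP ⊆ PQP := by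
  rw [← BQPGap_sixth_eq_BQP]
  exact BQPGap_subset_PQP fun _ => by norm_num

end API

/-! ### Error reduction for the gap dial (Watrous 2009, Prop. 3, midpoint `1/2`) -/

open Finset in
/-- **Majority vote over polynomially many copies, input-length–dependent advantage** (Bennett–
Bernstein–Brassard–Vazirani 1997, Thm. 4.13, in the tree's uniform Clifford+T model; the per-`n`
reading of `exists_poly_amplified`): for every polynomial-time uniform, oracle-free family `F`, every
polynomial `pK` and every advantage function `η` with `η(n) > 0`, the `K(n) = pK(n) + 1`-copy family
followed by the classical majority read-out accepts with probability `≥ 1 − 1/(4 K(|x|) η(|x|)²)`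
every `x` that `F` accepts with probability `≥ 1/2 + η(|x|)`, and with probability
`≤ 1/(4 K(|x|) η(|x|)²)` every `x` that `F` accepts with probability `≤ 1/2 − η(|x|)` (the amplified
family does not depend on `η`). [cite: BennettBernsteinBrassardVazirani1997, Thm. 4.13] -/
theorem exists_poly_amplified_fn {F : QCircuitFamily cliffordT} (hF : F.IsOracleFree) (hU : F.IsUniform)
    (pK : Polynomial ℕ) {η : ℕ → ℝ} (hη : ∀ n, 0 < η n) :
    ∃ F' : QCircuitFamily cliffordT, F'.IsOracleFree ∧ F'.IsUniform ∧ ∀ x : List Bool,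
      (1 / 2 + η x.length ≤ F.acceptProbOn 0 x →
        1 - 1 / (4 * (pK.eval x.length + 1 : ℕ) * η x.length ^ 2) ≤ F'.acceptProbOn 0 x) ∧
      (F.acceptProbOn 0 x ≤ 1 / 2 - η x.length →
        F'.acceptProbOn 0 x ≤ 1 / (4 * (pK.eval x.length + 1 : ℕ) * η x.length ^ 2)) := by
  obtain ⟨pF, hpF⟩ := QCircuitFamily.IsUniform.isPolySize' hU
  let P₀ : PolyCopies.Params := ⟨F, pF, fun n => (hpF n).2, pK⟩
  have hRfree : (PolyCopies.family P₀).IsOracleFree := PolyCopies.family_isOracleFree P₀ hF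
  have hRU : (PolyCopies.family P₀).IsUniform := PolyCopies.family_isUniform P₀ hU
  obtain ⟨P, hPh, hPg, hPF⟩ :=
    CWrap.exists_params (PolyTimeComputable.id _) (PolyCopies.majF_mem_FP (P := P₀)) hRU
  have hK : ∀ x : List Bool, PolyCopies.K P₀ x.length = pK.eval x.length + 1 := fun x => rfl
  refine ⟨CWrap.family P, CWrap.family_isOracleFree P (hPF ▸ hRfree), CWrap.family_isUniform P (hPF ▸ hRU),
    fun x => ⟨fun hx => ?_, fun hx => ?_⟩⟩
  · have hker := CWrap.kernelProb_family_ge P x (fun _ => {y | PolyCopies.majF P₀ (boolPair x y) = [true]})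
    rw [hPh, hPg, hPF] at hker
    have hsub : {z | ∃ y ∈ ({y | PolyCopies.majF P₀ (boolPair x y) = [true]} : Set (List Bool)),
        PolyCopies.majF P₀ (boolPair x y) <+: z} ⊆ {z | [true] <+: z} := by
      rintro z ⟨y, hy, hz⟩
      rw [Set.mem_setOf_eq] at hy
      rw [hy] at hz
      exact hz
    rw [← kernelProb_prefix_true_eq_acceptProbOn, ← hK]
    exact ((PolyCopies.kernelProb_majF_true_ge (P := P₀) x (hη x.length) hx).trans hker).trans
      ((CWrap.family P).kernelProb_mono 0 x hsub)
  · have hker := CWrap.kernelProb_family_ge P x (fun _ => {y | PolyCopies.majF P₀ (boolPair x y) = [false]})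
    rw [hPh, hPg, hPF] at hker
    have hsub : {z | ∃ y ∈ ({y | PolyCopies.majF P₀ (boolPair x y) = [false]} : Set (List Bool)),
        PolyCopies.majF P₀ (boolPair x y) <+: z} ⊆ {z | [false] <+: z} := by
      rintro z ⟨y, hy, hz⟩
      rw [Set.mem_setOf_eq] at hy
      rw [hy] at hz
      exact hz
    have h1 := ((PolyCopies.kernelProb_majF_false_ge (P := P₀) x (hη x.length) hx).trans hker).trans
      ((CWrap.family P).kernelProb_mono 0 x hsub)
    have h2 := kernelProb_add_kernelProb_le_one (CWrap.family P) 0 x disjoint_prefix_true_false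
    rw [kernelProb_prefix_true_eq_acceptProbOn] at h2
    rw [← hK]
    linarith

/-- **Inverse-polynomial gaps amplify to `BQP`** (Watrous 2009, Prop. 3 for `a = 1/2 + γ`,
`b = 1/2 − γ`, `a − b ≥ 2/(q+1)`): if `γ(n) ≥ 1/(q(n) + 1)` for a polynomial `q`, then
`BQPGap γ ⊆ BQP` — majority over `(q(n)+1)²` copies brings the error below `1/4`.
[cite: Watrous2009, §IV.2 Prop. 3] -/
theorem BQPGap_subset_BQP_of_inv_poly {γ : ℕ → ℝ}
    (h : ∃ q : Polynomial ℕ, ∀ n, 1 / (((q.eval n : ℕ) : ℝ) + 1) ≤ γ n) : BQPGap γ ⊆ BQP := by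
  obtain ⟨q, hq⟩ := h
  rintro L ⟨F, hF, hU, hL⟩
  have hγ : ∀ n, 0 < γ n := fun n => lt_of_lt_of_le (by positivity) (hq n)
  obtain ⟨F', hF', hU', hF'x⟩ := exists_poly_amplified_fn hF hU (q ^ 2 + 2 * q) hγ
  -- with `K(n) = q(n)² + 2 q(n) + 1 = (q(n)+1)²` copies the error is `≤ 1/4`
  have hbound : ∀ n : ℕ, 1 / (4 * ((q ^ 2 + 2 * q).eval n + 1 : ℕ) * γ n ^ 2) ≤ (1 : ℝ) / 4 := by
    intro n
    have hγn : 0 < γ n := hγ n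
    have hK : (((q ^ 2 + 2 * q).eval n + 1 : ℕ) : ℝ) = (((q.eval n : ℕ) : ℝ) + 1) ^ 2 := by
      push_cast [Polynomial.eval_add, Polynomial.eval_mul, Polynomial.eval_pow, Polynomial.eval_ofNat]
      ring
    rw [hK]
    have hq1 : (0 : ℝ) < ((q.eval n : ℕ) : ℝ) + 1 := by positivity
    have hprod : 1 ≤ (((q.eval n : ℕ) : ℝ) + 1) * γ n := by
      have := hq n
      rw [div_le_iff₀ hq1] at this
      linarith
    have hsq : 1 ≤ ((((q.eval n : ℕ) : ℝ) + 1) * γ n) ^ 2 := by nlinarith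
    rw [div_le_div_iff₀ (by positivity) (by norm_num)]
    nlinarith
  refine ClassBQP.mem_BQP_iff.2 ⟨F', hF', hU', fun x => ⟨fun hx => ?_, fun hx => ?_⟩⟩
  · have h1 := (hF'x x).1 ((hL x).1 hx)
    linarith [hbound x.length]
  · have h1 := (hF'x x).2 ((hL x).2 hx)
    linarith [hbound x.length]

/-- **`BQP` reaches every gap polynomially bounded away from `1/2`** (Watrous 2009, Prop. 3, the
inverse-polynomial-error direction; Bennett–Bernstein–Brassard–Vazirani 1997, Thm. 4.13 with
`9 (q(n)+1)` copies): if `γ(n) ≤ 1/2 − 1/(q(n)+1)` for a polynomial `q`, then `BQP ⊆ BQPGap γ`.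
[cite: Watrous2009, §IV.2 Prop. 3] -/
theorem BQP_subset_BQPGap_of_le {γ : ℕ → ℝ}
    (h : ∃ q : Polynomial ℕ, ∀ n, γ n ≤ 1 / 2 - 1 / (((q.eval n : ℕ) : ℝ) + 1)) : BQP ⊆ BQPGap γ := by
  obtain ⟨q, hq⟩ := h
  intro L hLmem
  obtain ⟨F, hF, hU, hL⟩ := ClassBQP.mem_BQP_iff.1 hLmem
  obtain ⟨F', hF', hU', hF'x⟩ := exists_poly_amplified hF hU (9 * q + 8) (η := 1 / 6) (by norm_num)
  -- with `K(n) = 9 (q(n)+1)` copies and advantage `1/6` the error is `≤ 1/(q(n)+1)`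
  have hbound : ∀ n : ℕ, 1 / (4 * ((9 * q + 8).eval n + 1 : ℕ) * (1 / 6 : ℝ) ^ 2) = 1 / (((q.eval n : ℕ) : ℝ) + 1) := by
    intro n
    have hK : (((9 * q + 8).eval n + 1 : ℕ) : ℝ) = 9 * (((q.eval n : ℕ) : ℝ) + 1) := by
      push_cast [Polynomial.eval_add, Polynomial.eval_mul, Polynomial.eval_ofNat]
      ring
    rw [hK]
    have hq1 : (0 : ℝ) < ((q.eval n : ℕ) : ℝ) + 1 := by positivity
    field_simp
    ring
  refine ⟨F', hF', hU', fun x => ⟨fun hx => ?_, fun hx => ?_⟩⟩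
  · have h1 := (hF'x x).1 (by linarith [(hL x).1 hx])
    rw [hbound] at h1
    dsimp only
    linarith [hq x.length]
  · have h1 := (hF'x x).2 (by linarith [(hL x).2 hx])
    rw [hbound] at h1
    dsimp only
    linarith [hq x.length]

/-- **Watrous's Prop. 3 for the gap dial**: a gap with `1/(q(n)+1) ≤ γ(n) ≤ 1/2 − 1/(q(n)+1)` for a
polynomial `q` defines exactly `BQP`. [cite: Watrous2009, §IV.2 Prop. 3] -/
theorem BQPGap_eq_BQP_of_inv_poly {γ : ℕ → ℝ}
    (h : ∃ q : Polynomial ℕ, ∀ n, 1 / (((q.eval n : ℕ) : ℝ) + 1) ≤ γ n ∧ γ n ≤ 1 / 2 - 1 / (((q.eval n : ℕ) : ℝ) + 1)) :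
    BQPGap γ = BQP := by
  obtain ⟨q, hq⟩ := h
  exact Set.Subset.antisymm (BQPGap_subset_BQP_of_inv_poly ⟨q, fun n => (hq n).1⟩)
    (BQP_subset_BQPGap_of_le ⟨q, fun n => (hq n).2⟩)

/-- **Every constant gap in `(0, 1/2)` gives `BQP`** (error reduction for constant error bounds, the
constant polynomial `q = ⌈1/c⌉ + ⌈1/(1/2 − c)⌉` in `BQPGap_eq_BQP_of_inv_poly`; cf. the tree theorem
`Cryptography.BQP_eq_BQPWith_holds` for `BQPWith`). [cite: Watrous2009, §IV.2 Prop. 3 (constant a, b)] -/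
theorem BQPGap_const_eq_BQP {c : ℝ} (h0 : 0 < c) (h : c < 1 / 2) : BQPGap (fun _ => c) = BQP := by
  refine BQPGap_eq_BQP_of_inv_poly ⟨Polynomial.C (⌈1 / c⌉₊ + ⌈1 / (1 / 2 - c)⌉₊), fun n => ?_⟩
  show 1 / ((((Polynomial.C (⌈1 / c⌉₊ + ⌈1 / (1 / 2 - c)⌉₊)).eval n : ℕ) : ℝ) + 1) ≤ c ∧
    c ≤ 1 / 2 - 1 / ((((Polynomial.C (⌈1 / c⌉₊ + ⌈1 / (1 / 2 - c)⌉₊)).eval n : ℕ) : ℝ) + 1)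
  rw [Polynomial.eval_C]
  push_cast
  have h1 : 1 / c ≤ (⌈1 / c⌉₊ : ℝ) := Nat.le_ceil _
  have h2 : 1 / (1 / 2 - c) ≤ (⌈1 / (1 / 2 - c)⌉₊ : ℝ) := Nat.le_ceil _
  have hc' : 0 < 1 / 2 - c := by linarith
  have hA : 0 ≤ (⌈1 / c⌉₊ : ℝ) := Nat.cast_nonneg _
  have hB : 0 ≤ (⌈1 / (1 / 2 - c)⌉₊ : ℝ) := Nat.cast_nonneg _
  set S : ℝ := (⌈1 / c⌉₊ : ℝ) + (⌈1 / (1 / 2 - c)⌉₊ : ℝ) + 1 with hS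
  have hS1 : 1 / c < S := by rw [hS]; linarith
  have hS2 : 1 / (1 / 2 - c) < S := by rw [hS]; linarith
  have hSpos : 0 < S := lt_trans (by positivity) hS1
  constructor
  · -- `1/S ≤ c` since `S > 1/c`
    rw [div_le_iff₀ hSpos]
    have := (div_lt_iff₀ h0).1 hS1
    linarith
  · -- `c ≤ 1/2 - 1/S` since `S > 1/(1/2 - c)`
    have := (div_lt_iff₀ hc').1 hS2
    have h3 : 1 / S < 1 / 2 - c := by
      rw [div_lt_iff₀ hSpos]; linarith
    linarith

end Literature.Computability.QuantumComplexity
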